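import Mathlib
import Summits.NavierStokesRegularity.NavierStokesRegularity.Theorems.WakeRatchetTailRatchetRelaySolvabilityLimit
import HarnessLib

/-!
# `WakeRatchet.TailRatchet` (stmt-NavierStokesRegularity-21808): the BORDERED linearised drain-free front
# problem `L₀h + σ·(1+t/2)e^{t} = f`, `h(0) = 0`, `h(−∞) = 0` is uniquely solvable — capstone of the
# linear theory at the relay profile

Support file for the crux `TailRatchet` (route `WakeRatchet`; MODEL lattice ODEs of Tao 2016 §1.2, §4 —
nothing in this file is a statement about the Navier–Stokes equations, and no item is closed here).

Context (files `…RelayProfile` … `…RelaySolvabilityLimit`; census of stmt-21808, programme "R-lac"): the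
implicit-function construction of scalar dyadic fronts for lacunary `Λ` (`δ = Λ⁻²` small) around the relay
profile `(b₀,s₀) = (e^{t},2)` linearises to the BORDERED problem
`L₀h + σ·g = f`,  `L₀h = h' − 2e^{t/2}h(t/2)`,  `g = ∂_sG(b₀,·)|_{s=2} = (1+t/2)e^{t}`,
for the profile correction `h` (normalised by `h(0) = 0`, decaying at `−∞`) and the correction `σ` of the
time ratio `s`.  Assembling the kernel (`…RelayKernel`), the adjoint mode and transversality
(`…RelayAdjoint`, `…RelayTransversality`: `τ = ∫w₁g ≠ 0`), Green's identity (`…RelayGreen`) and the backward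
solvability (`…RelaySolvability`, `…RelaySolvabilityLimit`), this file proves, sorry-free:

* `bordered_exists` — **EXISTENCE**: for every `f` continuous, bounded and integrable on `(−∞,0]` there are
  `σ = (∫w₁f)/τ` and `h` continuous on `ℝ`, bounded on `(−∞,0]`, with `h(0) = 0`, `h(t) → 0` as `t → −∞`,
  and `h' = 2e^{t/2}h(t/2) + f − σ g` on `t < 0`;
* `bordered_unique` — **UNIQUENESS**: two such pairs `(h₁,σ₁)`, `(h₂,σ₂)` (bounded, normalised, decaying)
  coincide: `σ₁ = σ₂` (Green + transversality) and `h₁ = h₂` on `(−∞,0]` (pantograph uniqueness).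

So on the bounded normalised class the bordered operator `(h,σ) ↦ L₀h + σg` is a BIJECTION onto
{continuous, bounded, integrable `f`} — the non-degeneracy an implicit function theorem needs.  Remaining
(census R-lac-2 tail, R-lac-3, R-lac-4): decay RATES (weighted spaces `X_γ`, `Y_γ`), the `C¹` dependence of
`G_δ(b,s)` on `(b,s,δ)` after fixing the dilation, and the IFT itself; fronts for lacunary `Λ` do NOT refute
`TailRatchet` (which needs `Λ → 1`).

HONEST FRAMING: elementary real analysis; MODEL lattice only; the construction item and the crux stay open.
-/

noncomputable section

set_option linter.dupNamespace false

namespace Summit.NavierStokesRegularity.NavierStokesRegularity.Theorems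

namespace WakeRatchetRelayBordered

open MeasureTheory Set Filter Topology Real intervalIntegral
open WakeRatchetRelayKernel WakeRatchetRelayTransversality WakeRatchetRelayGreen
  WakeRatchetRelaySolvability WakeRatchetRelaySolvabilityLimit

/-! ## The bordering direction `g = (1+t/2)e^{t}` -/

/-- `|(1+t/2)e^{t}| ≤ 2` on `t ≤ 0`. [folklore] -/
theorem weight_abs_le {t : ℝ} (ht : t ≤ 0) : |(1 + t / 2) * Real.exp t| ≤ 2 := by
  have h1 := abs_mul_exp_le_exp_neg_one ht
  have h2 : Real.exp (-1) ≤ 1 := Real.exp_le_one_iff.2 (by norm_num)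
  have h3 : Real.exp t ≤ 1 := Real.exp_le_one_iff.2 ht
  rw [abs_mul, abs_of_pos (Real.exp_pos _)]
  calc |1 + t / 2| * Real.exp t ≤ (|1| + |t / 2|) * Real.exp t :=
        mul_le_mul_of_nonneg_right (abs_add_le _ _) (Real.exp_pos _).le
    _ = Real.exp t + 1 / 2 * (|t| * Real.exp t) := by rw [abs_one, abs_div, abs_two]; ring
    _ ≤ 1 + 1 / 2 * 1 := by linarith
    _ ≤ 2 := by norm_num

variable {f : ℝ → ℝ} {A : ℝ}

/-! ## Existence -/

/-- **EXISTENCE for the bordered problem.**  For `f` continuous with `|f| ≤ A` on `(−∞,0]` and integrable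
there, put `σ := (∫_{(−∞,0]} w₁f) / τ`, `τ = ∫_{(−∞,0]} w₁(1+t/2)e^{t}` (`≠ 0`).  Then there is `h`,
continuous on `ℝ`, bounded on `(−∞,0]`, with `h(0) = 0`, `h → 0` at `−∞`, solving
`h' = 2e^{t/2}h(t/2) + f − σ(1+t/2)e^{t}` on `t < 0`, i.e. `L₀h + σg = f`.
[cite: Tao2016AveragedNS, §1.2 (dyadic model); cell vocabulary (bordered linearisation of the scalar front equation of `DyadicScalarFronts` at the relay profile; programme R-lac)] -/
theorem bordered_exists (hf : Continuous f) (hA : ∀ s : ℝ, s ≤ 0 → |f s| ≤ A)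
    (hfi : IntegrableOn f (Iic 0)) :
    ∃ σ : ℝ, ∃ h : ℝ → ℝ,
      σ = (∫ t in Iic (0 : ℝ), (∑' m : ℕ, (∏ i ∈ Finset.range m, ((-4 : ℝ) / (2 ^ (i + 1) - 1))) *
              Real.exp ((2 ^ m - 1) * t)) * f t) /
          (∫ t in Iic (0 : ℝ), (∑' m : ℕ, (∏ i ∈ Finset.range m, ((-4 : ℝ) / (2 ^ (i + 1) - 1))) *
              Real.exp ((2 ^ m - 1) * t)) * ((1 + t / 2) * Real.exp t)) ∧
      Continuous h ∧ h 0 = 0 ∧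
      (∀ t : ℝ, t < 0 → HasDerivAt h
        (2 * Real.exp (t / 2) * h (t / 2) + (f t - σ * ((1 + t / 2) * Real.exp t))) t) ∧
      (∃ B : ℝ, ∀ t : ℝ, t ≤ 0 → |h t| ≤ B) ∧ Tendsto h atBot (𝓝 0) := by
  set W : ℝ → ℝ := fun t : ℝ => ∑' m : ℕ,
      (∏ i ∈ Finset.range m, ((-4 : ℝ) / (2 ^ (i + 1) - 1))) * Real.exp ((2 ^ m - 1) * t) with hW
  set τ : ℝ := ∫ t in Iic (0 : ℝ), W t * ((1 + t / 2) * Real.exp t) with hτ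
  have hτ0 : τ ≠ 0 := transversality_ne_zero
  set σ : ℝ := (∫ t in Iic (0 : ℝ), W t * f t) / τ with hσ
  -- the modified right-hand side `f − σ g`
  set fs : ℝ → ℝ := fun t => f t - σ * ((1 + t / 2) * Real.exp t) with hfs
  have hfs_cont : Continuous fs := by
    simp only [hfs]; fun_prop
  have hfs_bd : ∀ s : ℝ, s ≤ 0 → |fs s| ≤ A + |σ| * 2 := by
    intro s hs
    simp only [hfs]
    calc |f s - σ * ((1 + s / 2) * Real.exp s)| ≤ |f s| + |σ * ((1 + s / 2) * Real.exp s)| :=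
          abs_sub _ _
      _ = |f s| + |σ| * |(1 + s / 2) * Real.exp s| := by rw [abs_mul]
      _ ≤ A + |σ| * 2 := add_le_add (hA s hs) (mul_le_mul_of_nonneg_left (weight_abs_le hs) (abs_nonneg _))
  have hg_int : IntegrableOn (fun t : ℝ => (1 + t / 2) * Real.exp t) (Iic 0) := by
    have := integrableOn_weight_exp_mul (k := 1) one_pos
    simpa only [one_mul] using this
  have hfs_int : IntegrableOn fs (Iic 0) := hfi.sub (hg_int.const_mul σ)
  obtain ⟨h, hc, h0, hde, ⟨B, hB⟩, hlim⟩ := pantograph_inhom_exists_bounded hfs_cont hfs_bd hfs_int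
  -- the limit is `−∫ W fs = −(∫ W f − σ τ) = 0`
  have hWcont : ContinuousOn W (Iic 0) := adjoint_continuousOn
  have hWae : ∀ᵐ t ∂(volume.restrict (Iic (0 : ℝ))), ‖W t‖ ≤ 71 :=
    (ae_restrict_iff' measurableSet_Iic).2 (Eventually.of_forall fun t ht => by
      rw [Real.norm_eq_abs]; exact adjoint_abs_le ht)
  have hI1 : IntegrableOn (fun t : ℝ => W t * f t) (Iic 0) :=
    Integrable.bdd_mul (c := 71) hfi (hWcont.aestronglyMeasurable measurableSet_Iic) hWae
  have hI2 : IntegrableOn (fun t : ℝ => W t * ((1 + t / 2) * Real.exp t)) (Iic 0) :=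
    Integrable.bdd_mul (c := 71) hg_int (hWcont.aestronglyMeasurable measurableSet_Iic) hWae
  have hsplit : ∫ t in Iic (0 : ℝ), W t * fs t = (∫ t in Iic (0 : ℝ), W t * f t) - σ * τ := by
    have hfun : (fun t : ℝ => W t * fs t) =
        fun t : ℝ => W t * f t - σ * (W t * ((1 + t / 2) * Real.exp t)) := by
      funext t; simp only [hfs]; ring
    rw [hfun, integral_sub hI1 (hI2.const_mul σ), MeasureTheory.integral_const_mul]
  have hzero : ∫ t in Iic (0 : ℝ), W t * fs t = 0 := by
    rw [hsplit, hσ, div_mul_cancel₀ _ hτ0, sub_self]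
  have hlim0 : Tendsto h atBot (𝓝 0) := by
    have := hlim
    rw [show (fun t : ℝ => (∑' m : ℕ, (∏ i ∈ Finset.range m, ((-4 : ℝ) / (2 ^ (i + 1) - 1))) *
        Real.exp ((2 ^ m - 1) * t)) * fs t) = fun t : ℝ => W t * fs t from rfl] at this
    rwa [hzero, neg_zero] at this
  exact ⟨σ, h, rfl, hc, h0, hde, ⟨B, hB⟩, hlim0⟩

/-! ## Uniqueness -/

/-- The derivative of a bounded solution of the bordered problem is integrable on `(−∞,0]`. [folklore] -/
theorem bordered_deriv_integrableOn (hfi : IntegrableOn f (Iic 0)) {σ : ℝ}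
    {h : ℝ → ℝ} (hcont : ContinuousOn h (Iic 0)) {B : ℝ} (hB : ∀ t : ℝ, t ≤ 0 → |h t| ≤ B) :
    IntegrableOn (fun t : ℝ => 2 * Real.exp (t / 2) * h (t / 2) +
      (f t - σ * ((1 + t / 2) * Real.exp t))) (Iic 0) := by
  have hB0 : 0 ≤ B := (abs_nonneg _).trans (hB 0 le_rfl)
  have h1 : IntegrableOn (fun s : ℝ => 2 * Real.exp (s / 2) * h (s / 2)) (Iic 0) := by
    have hmaj : IntegrableOn (fun s : ℝ => 2 * B * Real.exp ((1 / 2) * s)) (Iic 0) :=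
      (integrableOn_exp_mul_Iic (by norm_num : (0 : ℝ) < 1 / 2) 0).const_mul _
    have hh2 : ContinuousOn (fun s : ℝ => h (s / 2)) (Iic 0) :=
      hcont.comp (continuous_id.div_const 2).continuousOn
        (fun s hs => by simp only [mem_Iic] at hs ⊢; linarith)
    refine Integrable.mono' hmaj ?_ ?_
    · exact (((continuous_const.mul (Real.continuous_exp.comp (continuous_id.div_const 2))).continuousOn).mul
        hh2) |>.aestronglyMeasurable measurableSet_Iic
    · refine (ae_restrict_iff' measurableSet_Iic).2 (Eventually.of_forall fun s hs => ?_)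
      have hs2 : s / 2 ≤ 0 := by simp only [mem_Iic] at hs; linarith
      rw [Real.norm_eq_abs, abs_mul, abs_mul, abs_two, abs_of_pos (Real.exp_pos _),
        show (1 : ℝ) / 2 * s = s / 2 by ring]
      calc 2 * Real.exp (s / 2) * |h (s / 2)| ≤ 2 * Real.exp (s / 2) * B :=
          mul_le_mul_of_nonneg_left (hB _ hs2) (by positivity)
        _ = 2 * B * Real.exp (s / 2) := by ring
  have hg_int : IntegrableOn (fun t : ℝ => (1 + t / 2) * Real.exp t) (Iic 0) := by
    have := integrableOn_weight_exp_mul (k := 1) one_pos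
    simpa only [one_mul] using this
  exact h1.add (hfi.sub (hg_int.const_mul σ))

/-- **UNIQUENESS for the bordered problem.**  If `(h₁,σ₁)` and `(h₂,σ₂)` both solve
`h' = 2e^{t/2}h(t/2) + f − σ(1+t/2)e^{t}` on `t < 0` with `hᵢ` continuous and bounded on `(−∞,0]`,
`hᵢ(0) = 0` and `hᵢ → 0` at `−∞`, then `σ₁ = σ₂` and `h₁ = h₂` on `(−∞,0]`.
[cite: Tao2016AveragedNS, §1.2 (dyadic model); cell vocabulary (bordered linearisation at the relay profile; programme R-lac)] -/
theorem bordered_unique {σ₁ σ₂ : ℝ}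
    {h₁ h₂ : ℝ → ℝ} (hc₁ : ContinuousOn h₁ (Iic 0)) (hc₂ : ContinuousOn h₂ (Iic 0))
    (hd₁ : ∀ t : ℝ, t < 0 → HasDerivAt h₁
      (2 * Real.exp (t / 2) * h₁ (t / 2) + (f t - σ₁ * ((1 + t / 2) * Real.exp t))) t)
    (hd₂ : ∀ t : ℝ, t < 0 → HasDerivAt h₂
      (2 * Real.exp (t / 2) * h₂ (t / 2) + (f t - σ₂ * ((1 + t / 2) * Real.exp t))) t)
    {B₁ B₂ : ℝ} (hB₁ : ∀ t : ℝ, t ≤ 0 → |h₁ t| ≤ B₁) (hB₂ : ∀ t : ℝ, t ≤ 0 → |h₂ t| ≤ B₂)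
    (h0₁ : h₁ 0 = 0) (h0₂ : h₂ 0 = 0)
    (hl₁ : Tendsto h₁ atBot (𝓝 0)) (hl₂ : Tendsto h₂ atBot (𝓝 0)) :
    σ₁ = σ₂ ∧ ∀ t : ℝ, t ≤ 0 → h₁ t = h₂ t := by
  set W : ℝ → ℝ := fun t : ℝ => ∑' m : ℕ,
      (∏ i ∈ Finset.range m, ((-4 : ℝ) / (2 ^ (i + 1) - 1))) * Real.exp ((2 ^ m - 1) * t) with hW
  have hτ0 : (∫ t in Iic (0 : ℝ), W t * ((1 + t / 2) * Real.exp t)) ≠ 0 := transversality_ne_zero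
  -- the difference `d = h₁ − h₂`, `ρ = σ₁ − σ₂`
  set d : ℝ → ℝ := fun t => h₁ t - h₂ t with hd_def
  have hdc : ContinuousOn d (Iic 0) := hc₁.sub hc₂
  have hdd : ∀ t : ℝ, t < 0 → HasDerivAt d
      (2 * Real.exp (t / 2) * d (t / 2) + (0 - (σ₁ - σ₂) * ((1 + t / 2) * Real.exp t))) t := by
    intro t ht
    refine ((hd₁ t ht).sub (hd₂ t ht)).congr_deriv ?_
    simp only [hd_def]; ring
  have hdB : ∀ t : ℝ, t ≤ 0 → |d t| ≤ B₁ + B₂ := by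
    intro t ht
    simp only [hd_def]
    exact (abs_sub _ _).trans (add_le_add (hB₁ t ht) (hB₂ t ht))
  have hd0 : d 0 = 0 := by simp [hd_def, h0₁, h0₂]
  have hdl : Tendsto d atBot (𝓝 0) := by simpa using hl₁.sub hl₂
  -- Green's identity for `d` with the (zero) forcing `0 − ρ g`
  have hint := bordered_deriv_integrableOn (f := fun _ => (0 : ℝ))
    integrableOn_zero (σ := σ₁ - σ₂) hdc hdB
  have hG := adjoint_green W hW hdc hdd hdB hint hdl
  rw [hd0, mul_zero, sub_zero] at hG
  have hfun : (fun t : ℝ => W t * (2 * Real.exp (t / 2) * d (t / 2) +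
      (0 - (σ₁ - σ₂) * ((1 + t / 2) * Real.exp t)) - 2 * Real.exp (t / 2) * d (t / 2))) =
      fun t : ℝ => -(σ₁ - σ₂) * (W t * ((1 + t / 2) * Real.exp t)) := by
    funext t; ring
  rw [hfun, MeasureTheory.integral_const_mul] at hG
  have hρ : σ₁ - σ₂ = 0 := by
    have := mul_eq_zero.1 hG
    rcases this with h | h
    · linarith
    · exact absurd h hτ0
  have hσ : σ₁ = σ₂ := by linarith
  refine ⟨hσ, ?_⟩
  -- with `ρ = 0`, `d` solves the homogeneous equation with `d(0) = 0`
  have hdd' : ∀ t : ℝ, t < 0 → HasDerivAt d (2 * Real.exp (t / 2) * d (t / 2)) t := by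
    intro t ht
    refine (hdd t ht).congr_deriv ?_
    rw [hρ]; ring
  intro t ht
  have := pantograph_eq_zero hdc hdd' hd0 t ht
  simp only [hd_def] at this
  linarith

end WakeRatchetRelayBordered

end Summit.NavierStokesRegularity.NavierStokesRegularity.Theorems

end
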